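import Mathlib
import Summits.AtomisticToContinuum.Crystallization.Theorems.ChargedEnergyGap.Negative.Unconditional
import Summits.AtomisticToContinuum.Crystallization.Theorems.ChessboardParticlePlanesLjLaminarWindowsMinDistance
import Literature.MathematicalPhysics.StatisticalMechanics.LennardJonesClusters
import Literature.MathematicalPhysics.StatisticalMechanics.TwoScaleShellSums
import HarnessLib

/-!
# Glue lemmas of line `Sketch` (crux `LjLaminarWindows`, stmt-AtomisticToContinuum-6711): levels ⇒ isometry, exposed nearest particle, row bounds, separation density

Support file for the GLUE theorem `stub_glue : LjLaminarity → NoFoam → LjLaminarWindows`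
(`…ChessboardParticlePlanesLjLaminarWindowsGlue.lean`): the elementary lemmas of the line's composition
(lead prover-line-stmt-AtomisticToContinuum-6711-0, rev. 3; moved to the tree by the continuation lead
c1) and the registered stub `stub_separationDensity` — the separation-density input of the composition,
now a THEOREM because every Lennard-Jones ground state is `7/10`-separated (`stub_minDistance07`,
`…MinDistance.lean`), so its bad set is empty.

Revision of 2026-08-17 (import incident; line `stacking-blind-budget-flatness`, stub
`stub_cruxOfOneWindowAllScales`, lead a1): the import of
`…Theorems.PalmUnimodularRigidityMinimiserShellsEquilibriumInLawShells` — used only for the one-pair bound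
`|V_LJ(t)| ≤ (δ⁻⁶/12 + 1/6) t⁻⁶` inside `row_abs_lennardJones_le` — is replaced by
`Literature.MathematicalPhysics.StatisticalMechanics.TwoScaleShellSums`, whose
`abs_lennardJones_le_inv_pow_six` has the identical statement.  The old import transitively pulled in
`Literature…MuGSC`, which declares `Literature.MathematicalPhysics.StatisticalMechanics.UniformlyDiscrete` a second
time next to `Literature…MuGroundStateConfiguration` (imported by the route file `Theses/ChessboardParticlePlanes.lean`
since its rev. 4), so that this module and its 34 importers `…LjLaminarWindows{GlueC5, …, OneWindowAllScales}` could no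
longer be imported next to the route file.  All declarations and statements are unchanged; the landing anchor
`s9b_glueLevels_anchor` (a re-export of `levels_gap`) is appended.
-/

noncomputable section

open scoped BigOperators
open MeasureTheory Metric Filter Topology
open Literature.MathematicalPhysics.StatisticalMechanics
open Summit.AtomisticToContinuum.Crystallization.Theorems.ChargedEnergyGapNegative

namespace Summit.AtomisticToContinuum.Crystallization.Theorems.LjLaminarWindowsSketch

/-! ## Helper lemmas of the composition -/

/-- Row sums of `|V_LJ|` over a `δ`-separated configuration of `ℝ³` are bounded by
`M(δ) = (δ⁻⁶/12 + 1/6)·250·δ⁻⁶` (shell sum `sum_inv_pow_six_le`; the one-pair bound is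
`TwoScaleShellSums.abs_lennardJones_le_inv_pow_six`). [folklore] -/
theorem row_abs_lennardJones_le {N : ℕ} (x : Fin N → E3) {δ : ℝ} (hδ : 0 < δ)
    (hsep : ∀ k l : Fin N, k ≠ l → δ ≤ dist (x k) (x l)) (j : Fin N) :
    ∑ k ∈ Finset.univ.erase j, |lennardJones (dist (x j) (x k))| ≤
      (δ⁻¹ ^ 6 / 12 + 1 / 6) * (250 * δ⁻¹ ^ 6) := by
  have h6 := sum_inv_pow_six_le x hδ hsep j
  have hc : 0 ≤ δ⁻¹ ^ 6 / 12 + 1 / 6 := by positivity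
  calc ∑ k ∈ Finset.univ.erase j, |lennardJones (dist (x j) (x k))|
      ≤ ∑ k ∈ Finset.univ.erase j, (δ⁻¹ ^ 6 / 12 + 1 / 6) * (dist (x j) (x k))⁻¹ ^ 6 :=
        Finset.sum_le_sum fun k hk =>
          -- one-pair bound from `TwoScaleShellSums` (rev. 2026-08-17: was `…EquilibriumInLaw.Shells…`)
          abs_lennardJones_le_inv_pow_six hδ (hsep j k (Finset.ne_of_mem_erase hk).symm)
    _ = (δ⁻¹ ^ 6 / 12 + 1 / 6) * ∑ k ∈ Finset.univ.erase j, (dist (x j) (x k))⁻¹ ^ 6 := by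
        rw [Finset.mul_sum]
    _ ≤ (δ⁻¹ ^ 6 / 12 + 1 / 6) * (250 * δ⁻¹ ^ 6) := mul_le_mul_of_nonneg_left h6 hc

/-- **Far centre ⇒ exposed nearest particle.** If the particle `i` nearest to a point `c` is at
distance `> a ≥ r₀`, then `i` is `(r₀, a+2)`-exposed: some point within `a + 2` of `xᵢ` is at
distance `≥ r₀` from every particle (the point `c` itself if `dist ≤ a + 2`, else the point of the
segment `[xᵢ, c]` at distance `a + 2` from `xᵢ`). [folklore] -/
theorem exposed_of_far {N : ℕ} (x : Fin N → E3) (c : E3) (i : Fin N) {a r₀ : ℝ} (hr₀ : r₀ ≤ a)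
    (ha : 0 ≤ a) (hmin : ∀ j, dist (x i) c ≤ dist (x j) c) (hfar : a < dist (x i) c) :
    ∃ p : E3, dist p (x i) ≤ a + 2 ∧ ∀ j : Fin N, r₀ ≤ dist p (x j) := by
  by_cases hd : dist (x i) c ≤ a + 2
  · refine ⟨c, by rwa [dist_comm], fun j => ?_⟩
    rw [dist_comm]
    linarith [hmin j]
  · push Not at hd
    set d : ℝ := dist (x i) c with hd_def
    have hdpos : 0 < d := by linarith
    have hnorm : ‖c - x i‖ = d := by rw [← dist_eq_norm, dist_comm]
    refine ⟨x i + ((a + 2) / d) • (c - x i), ?_, fun j => ?_⟩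
    · rw [dist_eq_norm, add_sub_cancel_left, norm_smul, Real.norm_eq_abs,
        abs_of_pos (by positivity), hnorm, div_mul_cancel₀ _ hdpos.ne']
    · have hcp : dist c (x i + ((a + 2) / d) • (c - x i)) = d - (a + 2) := by
        have : c - (x i + ((a + 2) / d) • (c - x i)) = (1 - (a + 2) / d) • (c - x i) := by
          rw [sub_smul, one_smul]; abel
        rw [dist_eq_norm, this, norm_smul, Real.norm_eq_abs, hnorm,
          abs_of_nonneg (by rw [sub_nonneg, div_le_one hdpos]; linarith)]
        field_simp
      have htri := dist_triangle c (x i + ((a + 2) / d) • (c - x i)) (x j)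
      have hj := hmin j
      rw [dist_comm (x j)] at hj
      linarith

/-- Levels with consecutive gaps `≥ 3/4` are `3/4`-separated: `c k + 3/4·(m+1) ≤ c (k + (m+1))`.
[folklore] -/
theorem levels_gap (c : ℤ → ℝ) (hc : ∀ k : ℤ, c k + 3 / 4 ≤ c (k + 1)) (k : ℤ) (m : ℕ) :
    c k + 3 / 4 * (m + 1 : ℝ) ≤ c (k + (m + 1 : ℕ)) := by
  induction m with
  | zero => simpa using hc k
  | succ m ih =>
    have h := hc (k + (m + 1 : ℕ))
    have e : k + ((m + 1 + 1 : ℕ) : ℤ) = k + ((m + 1 : ℕ) : ℤ) + 1 := by push_cast; ring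
    rw [e]
    push_cast at ih h ⊢
    linarith

/-- The range of such levels is a `3/4`-separated set. [folklore] -/
theorem levels_separated (c : ℤ → ℝ) (hc : ∀ k : ℤ, c k + 3 / 4 ≤ c (k + 1)) :
    ∀ s ∈ Set.range c, ∀ s' ∈ Set.range c, s ≠ s' → (3 : ℝ) / 4 ≤ |s - s'| := by
  rintro _ ⟨k, rfl⟩ _ ⟨k', rfl⟩ hne
  have key : ∀ k k' : ℤ, k < k' → (3 : ℝ) / 4 ≤ c k' - c k := by
    intro k k' hlt
    obtain ⟨m, hm⟩ : ∃ m : ℕ, k' = k + (m + 1 : ℕ) := by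
      refine ⟨(k' - k - 1).toNat, ?_⟩
      have : 0 ≤ k' - k - 1 := by omega
      push_cast
      rw [Int.toNat_of_nonneg this]
      ring
    have h := levels_gap c hc k m
    rw [← hm] at h
    have : (0 : ℝ) ≤ m := Nat.cast_nonneg m
    nlinarith
  rcases lt_trichotomy k k' with h | h | h
  · have := key k k' h
    rw [abs_sub_comm, abs_of_nonneg (by linarith)]
    exact this
  · exact absurd (congrArg c h) hne
  · have := key k' k h
    rw [abs_of_nonneg (by linarith)]
    exact this

/-- **Levels ⇒ isometry.** A unit normal `n` and levels `c` (gaps `≥ 3/4`) controlling the window of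
`i` give a linear isometry `A` (coordinates in an orthonormal basis with third vector `n`, so that
`(A v)₂ = ⟪v, n⟫`) and the `3/4`-separated height set `T = range c` of the crux's laminarity
clause. [folklore] -/
theorem laminar_of_levels {N : ℕ} (y : Fin N → E3) (i : Fin N) (R t : ℝ) (n : E3) (hn : ‖n‖ = 1)
    (c : ℤ → ℝ) (hc : ∀ k : ℤ, c k + 3 / 4 ≤ c (k + 1))
    (h : ∀ j : Fin N, dist (y j) (y i) ≤ R → ∃ k : ℤ, |inner ℝ (y j - y i) n - c k| ≤ t) :
    ∃ (A : E3 →ₗᵢ[ℝ] E3) (T : Set ℝ), (∀ s ∈ T, ∀ s' ∈ T, s ≠ s' → (3 : ℝ) / 4 ≤ |s - s'|) ∧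
      ∀ j : Fin N, dist (y j) (y i) ≤ R → ∃ s ∈ T, |(A (y j - y i)) 2 - s| ≤ t := by
  have hon : Orthonormal ℝ (({(2 : Fin 3)} : Set (Fin 3)).restrict fun _ : Fin 3 => n) := by
    refine ⟨fun _ => by simpa using hn, ?_⟩
    intro a b hab
    exact absurd (Subsingleton.elim a b) hab
  obtain ⟨b, hb⟩ := Orthonormal.exists_orthonormalBasis_extension_of_card_eq
    (𝕜 := ℝ) (E := E3) (ι := Fin 3) (by simp) hon
  have hb2 : b 2 = n := hb 2 (by simp)
  refine ⟨b.repr.toLinearIsometry, Set.range c, levels_separated c hc, fun j hj => ?_⟩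
  obtain ⟨k, hk⟩ := h j hj
  refine ⟨c k, ⟨k, rfl⟩, ?_⟩
  have : (b.repr.toLinearIsometry (y j - y i)) 2 = inner ℝ (y j - y i) n := by
    show b.repr (y j - y i) 2 = inner ℝ (y j - y i) n
    rw [b.repr_apply_apply, hb2, real_inner_comm]
  rw [this]
  exact hk

/-! ## Counting and volume lemmas of the composition -/

/-- Shell count = difference of ball counts: `#{L − a < d ≤ L + a} = #{d ≤ L + a} − #{d ≤ L − a}`
for `a ≥ 0`. [folklore] -/
theorem glue_shell_card (N : ℕ) (d : Fin N → ℝ) (L a : ℝ) (ha : 0 ≤ a) :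
    ((Finset.univ.filter fun j : Fin N => L - a < d j ∧ d j ≤ L + a).card : ℝ) =
      ((Finset.univ.filter fun j : Fin N => d j ≤ L + a).card : ℝ) -
        ((Finset.univ.filter fun j : Fin N => d j ≤ L - a).card : ℝ) := by
  have hdisj : Disjoint (Finset.univ.filter fun j : Fin N => L - a < d j ∧ d j ≤ L + a)
      (Finset.univ.filter fun j : Fin N => d j ≤ L - a) := by
    rw [Finset.disjoint_filter]
    intro j _ hj1 hj2
    linarith [hj1.1]
  have hunion : (Finset.univ.filter fun j : Fin N => L - a < d j ∧ d j ≤ L + a) ∪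
      (Finset.univ.filter fun j : Fin N => d j ≤ L - a) =
        Finset.univ.filter fun j : Fin N => d j ≤ L + a := by
    ext j
    simp only [Finset.mem_union, Finset.mem_filter, Finset.mem_univ, true_and]
    constructor
    · rintro (hj | hj)
      · exact hj.2
      · linarith
    · intro hj
      by_cases hj' : d j ≤ L - a
      · exact Or.inr hj'
      · exact Or.inl ⟨lt_of_not_ge hj', hj⟩
  have hcard := Finset.card_union_of_disjoint hdisj
  rw [hunion] at hcard
  rw [hcard]
  push_cast
  ring

/-- Packing bound for ball counts: a `δ`-separated injective configuration has at most `(2L/δ + 1)³`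
points in any closed ball of radius `L ≥ 0` (`card_le_of_separated_of_dist_le`). [folklore] -/
theorem glue_ball_card_le (N : ℕ) (y : Fin N → E3) (hy : Function.Injective y) {δ : ℝ} (hδ : 0 < δ)
    (hsep : ∀ j k : Fin N, j ≠ k → δ ≤ dist (y j) (y k)) (c : E3) {L : ℝ} (hL : 0 ≤ L) :
    ((Finset.univ.filter fun j : Fin N => dist (y j) c ≤ L).card : ℝ) ≤ (2 * L / δ + 1) ^ 3 := by
  classical
  set F : Finset (Fin N) := Finset.univ.filter fun j : Fin N => dist (y j) c ≤ L with hF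
  have hcard : ((F.image y).card : ℝ) = (F.card : ℝ) := by
    rw [Finset.card_image_of_injective _ hy]
  have h := card_le_of_separated_of_dist_le (F.image y) c hδ hL ?_ ?_
  · rw [finrank_euclideanSpace_fin] at h
    rw [← hcard]
    exact_mod_cast h
  · intro p hp
    obtain ⟨j, hj, rfl⟩ := Finset.mem_image.1 hp
    exact (Finset.mem_filter.1 hj).2
  · intro p hp q hq hpq
    obtain ⟨j, -, rfl⟩ := Finset.mem_image.1 hp
    obtain ⟨k, -, rfl⟩ := Finset.mem_image.1 hq
    exact hsep j k fun h => hpq (h ▸ rfl)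

/-- Shell volume: `n·(4/3)π((L+a)³ − (L−a)³) ≤ (32/3)π a³ L² n` for `a, L ≥ 1`, `n ≥ 0`. [folklore] -/
theorem glue_shell_volume_le {L a n : ℝ} (ha1 : 1 ≤ a) (hL1 : 1 ≤ L) (hn : 0 ≤ n) :
    n * (4 / 3 * Real.pi * (L + a) ^ 3) - n * (4 / 3 * Real.pi * (L - a) ^ 3) ≤
      32 / 3 * Real.pi * a ^ 3 * L ^ 2 * n := by
  have ha0 : 0 < a := by linarith
  have ha2 : (1 : ℝ) ≤ a ^ 2 := one_le_pow₀ ha1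
  have h1 : a ≤ a ^ 3 := by
    calc a = a * 1 := (mul_one a).symm
      _ ≤ a * a ^ 2 := mul_le_mul_of_nonneg_left ha2 ha0.le
      _ = a ^ 3 := by ring
  have h2 : 6 * L ^ 2 * a ≤ 6 * L ^ 2 * a ^ 3 := mul_le_mul_of_nonneg_left h1 (by positivity)
  have hL2 : (1 : ℝ) ≤ L ^ 2 := one_le_pow₀ hL1
  have h3 : 2 * a ^ 3 ≤ 2 * a ^ 3 * L ^ 2 := le_mul_of_one_le_right (by positivity) hL2
  have e0 : (L + a) ^ 3 - (L - a) ^ 3 = 6 * L ^ 2 * a + 2 * a ^ 3 := by ring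
  have h4 : (L + a) ^ 3 - (L - a) ^ 3 ≤ 8 * a ^ 3 * L ^ 2 := by linarith only [e0, h2, h3]
  have h5 := mul_le_mul_of_nonneg_left h4 (by positivity : (0 : ℝ) ≤ 4 / 3 * Real.pi * n)
  have e1 : n * (4 / 3 * Real.pi * (L + a) ^ 3) - n * (4 / 3 * Real.pi * (L - a) ^ 3) =
      4 / 3 * Real.pi * n * ((L + a) ^ 3 - (L - a) ^ 3) := by ring
  have e2 : 4 / 3 * Real.pi * n * (8 * a ^ 3 * L ^ 2) = 32 / 3 * Real.pi * a ^ 3 * L ^ 2 * n := by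
    ring
  linarith only [h5, e1, e2]

/-- `Nat.card` of a decidable subtype of `Fin N` is the card of the filtered `Finset.univ` (cast to `ℝ`).
[folklore] -/
theorem glue_natCard_filter (N : ℕ) (p : Fin N → Prop) [DecidablePred p] :
    (Nat.card {i : Fin N // p i} : ℝ) = ((Finset.univ.filter p).card : ℝ) := by
  have e : {i : Fin N // p i} ≃ {i // i ∈ Finset.univ.filter p} :=
    Equiv.subtypeEquivRight (fun i => by simp)
  rw [Nat.card_congr e, Nat.card_eq_finsetCard]

/-! ## Separation density (registered stub `stub_separationDensity`) -/

/-- **Separation density at `7/10` (registered stub `stub_separationDensity` of line `Sketch`)**: along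
every sequence of Lennard-Jones ground states and for every `R > 0`, the fraction of particles whose
`R`-ball contains two particles at distance `< 7/10` tends to `0` — indeed it is identically `0`, the
bad set being empty by `stub_minDistance07`. [folklore] -/
theorem stub_separationDensity :
    ∀ R : ℝ, 0 < R → ∀ x : (N : ℕ) → (Fin N → EuclideanSpace ℝ (Fin 3)),
      (∀ N, IsGroundState lennardJones (x N)) →
      Filter.Tendsto (fun N : ℕ => (Nat.card {i : Fin N // ∃ j k : Fin N, j ≠ k ∧
        dist (x N j) (x N i) ≤ R ∧ dist (x N k) (x N i) ≤ R ∧ dist (x N j) (x N k) < 7 / 10} : ℝ) / N)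
        Filter.atTop (nhds 0) := by
  intro R _ x hx
  have hzero : ∀ N : ℕ, (Nat.card {i : Fin N // ∃ j k : Fin N, j ≠ k ∧
      dist (x N j) (x N i) ≤ R ∧ dist (x N k) (x N i) ≤ R ∧ dist (x N j) (x N k) < 7 / 10} : ℝ) / N
        = 0 := by
    intro N
    have hempty : IsEmpty {i : Fin N // ∃ j k : Fin N, j ≠ k ∧
        dist (x N j) (x N i) ≤ R ∧ dist (x N k) (x N i) ≤ R ∧ dist (x N j) (x N k) < 7 / 10} := by
      refine ⟨fun ⟨i, j, k, hjk, _, _, hlt⟩ => ?_⟩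
      exact absurd (stub_minDistance07 N (x N) (hx N) j k hjk) (not_le.2 hlt)
    rw [Nat.card_of_isEmpty]
    simp
  simp_rw [hzero]
  exact tendsto_const_nhds

/-- Landing anchor of the 2026-08-17 revision (registered sub-goal `s9b_glueLevels_anchor` of crux
stmt-AtomisticToContinuum-6711, line `stacking-blind-budget-flatness`; re-exports `levels_gap`). [folklore] -/
theorem s9b_glueLevels_anchor :
    ∀ (c : ℤ → ℝ), (∀ k : ℤ, c k + 3 / 4 ≤ c (k + 1)) → ∀ (k : ℤ) (m : ℕ), c k + 3 / 4 * (m + 1 : ℝ) ≤ c (k + (m + 1 : ℕ)) :=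
  fun c hc k m => levels_gap c hc k m

end Summit.AtomisticToContinuum.Crystallization.Theorems.LjLaminarWindowsSketch

end
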